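import Summits.BirchSwinnertonDyer.BirchSwinnertonDyer.Theorems.TwoAdicConverseOffHabitatStrata
import Summits.BirchSwinnertonDyer.Rank1Residual.X12.CMIsogenyInvariance
import Literature.NumberTheory.EllipticCurves.Greenberg1999.TwoTorsionRamifiedIsogenyDualProofs
import Literature.NumberTheory.EllipticCurves.IsogenyTwoPowerQuotientProofs
import Literature.NumberTheory.EllipticCurves.IsogenyVariableChangeProofs
import Literature.NumberTheory.EllipticCurves.IsogenyCompProofs
import Literature.NumberTheory.EllipticCurves.IsogenyDualProofs
import Literature.NumberTheory.EllipticCurves.BSDSelmerCMPConverseMaximalOrderProofs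
import Literature.NumberTheory.EllipticCurves.BSDSelmerSmithIsogenyProofs
import Literature.NumberTheory.EllipticCurves.ComplexMultiplicationLFunctionIsogenyHoldsProofs
import HarnessLib

/-!
# Route `TwoAdicConverse` (rung S3), item 19218 `GoodOrdinaryRankZeroTwoConverse`: the rational-`2`-torsion
# stratum (β) of the off-habitat complement, organised by `ℤ/2`-linked PAIRS — the «neither» configuration
# is eliminated, Greenberg's Prop. 5.14 (μ = 0) road is a property of the pair, 5.13 (μ ≥ 1) pairs with «neither»

Cell `bsd-2adic` (run/shared/lean/pub/bsd-2adic/), seat `bsd-2adic-conv-1` (GEN 19).  THEOREMS ONLY — no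
definition, no named fact, no `sorry`; `--supports stmt-BirchSwinnertonDyer-19218`.  HONEST FRAMING: BSD is
not proved by any of this; item 19218 (the ∀ rank-`0` `2`-converse at a good ordinary `2`) and its research
inputs (Kolyvagin at `2` on the habitat: 24622/24623 resp. 27014/27015; the `λ`-half 19556 off the habitat)
stay OPEN.  PARTITION (D-0054): none — RANK axis (S3); stratum (β) = «`E(ℚ)[2] ≠ 0`» of the good-ordinary
off-habitat complement (census 169/611 classes: 83 with a Prop-5.14 point, 86 without).

**Setting.** `W/ℚ` globally minimal, good ordinary at `2`, with a rational point `P = (x₀, y₀)` of order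
`2`; `C = (1, x₀, -a₁/2, y₀)` puts `W` in two-torsion normal form `V = C • W` (`P ↦ (0,0)`), Silverman's
explicit `2`-isogeny has codomain `V' = V.twoIsogenyCodomain`, and a globally minimal model `W'` of `V'`
(Laska, `hasGlobalMinimalModel_rat_holds`) is linked by `C' • W' = V'`; `P' = (C'.r, C'.t)` generates the
kernel of the dual isogeny.  (`W`, `W'`) is a **`ℤ/2`-linked pair**.

**Theorems.**
* §1 `isIsogenous_of_twoTorsionPair`: `W ∼ W'`; hence `GoodOrd W 2 ↔ GoodOrd W' 2`, equal
  `corank_{ℤ₂} Sel_{2^∞}`, equal analytic rank, `HasCM ↔ HasCM` — so 19218's instance at `W` is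
  EQUIVALENT to its instance at `W'` (`rankZeroTwoConverseAt_iff_of_twoTorsionPair`).
* §2 Greenberg's PRINT facts read on the pair (binders `h514 : prop514_isTorsion_mu_eq_zero_two`,
  `h513 : prop513_one_le_mu_two_of_ramified_odd`, displayed, not proved): a Prop-5.14 point on `W` gives
  `X(·/ℚ_∞)` `Λ`-torsion with `μ = 0` for BOTH `W` and `W'` (`isTorsion_mu_eq_zero_both_of_prop514`, via the
  KERNEL duality `prop514Hypothesis_iff_of_twoIsogeny`); a Prop-5.13 point (ramified AND odd) on `W` gives
  `μ(W) ≥ 1` and leaves `P'` «NEITHER ramified nor odd», so that 5.14's hypothesis FAILS at `(W, P)` and at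
  `(W', P')` (`prop513_obstruction_of_twoTorsionPair`) — the typed reason the `μ = 0`-by-5.14 road is EMPTY
  on the 86 «pure» classes, member by member along the `2`-isogeny.
* §3 **The (β) piece of 19218 SHRINKS to two configurations**
  (`goodOrd_twoTorsion_rankZero_of_mixed_of_ramifiedOdd`): the rank-`0` `2`-converse for every non-CM
  good-ordinary-at-`2` curve with a rational point of order `2` follows from (M) the converse for curves
  carrying a Prop-5.14 («mixed») point and (R) the converse for curves carrying a Prop-5.13 («ramified and
  odd») point — a curve whose point is «neither» is replaced by its partner `W'`, where `P'` is ramified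
  and odd (kernel theorem `neither_iff_ramified_and_odd_of_twoIsogeny`), all four data of the converse
  being isogeny invariants.  §4 re-keys conv-1 GEN 18's three-strata conclusion of 19218 BY NAME
  (`goodOrdinaryRankZeroTwoConverse_of_kolyvaginAtTwo_of_three_strata`, p616174) to FOUR pieces
  (M), (R), (γ₁), (γ₂) next to the Kolyvagin cone on the habitat (24622 V1′ + 24623 V2♭ + 24405 + PRINT).

References: R. Greenberg, LNM 1716 (1999), §5 Props. 5.13–5.14, pp. 120–124 [GreenbergLNM1716];
J. H. Silverman, *AEC*, III.4.5, III.6, VII.7.2, VIII.8.3 [SilvermanAEC2009]; W. Zhang, Camb. J. Math. 2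
(2014) Thm. 1.1 (the Kolyvagin shape, `p ≥ 5`) [WZhang2014].
-/

set_option linter.dupNamespace false  -- `BirchSwinnertonDyer.BirchSwinnertonDyer` is the sub's path (D-0017)
set_option autoImplicit false

noncomputable section

open scoped Classical
open WeierstrassCurve Literature Literature.NumberTheory.EllipticCurves
  Literature.NumberTheory.EllipticCurves.ModularForms
  Literature.NumberTheory.EllipticCurves.Rank1Residual
  Literature.NumberTheory.EllipticCurves.Greenberg1999
  Summit.BirchSwinnertonDyer.BirchSwinnertonDyer.Theses.TwoAdicConverse
  Summit.BirchSwinnertonDyer.BirchSwinnertonDyer.Theorems.TwoAdicKolyvaginRankZero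

namespace Summit.BirchSwinnertonDyer.BirchSwinnertonDyer.Theorems.TwoAdicOffHabitat

/-! ## §1 A `ℤ/2`-linked pair is an isogeny: the four data of the `2`-converse agree -/

section Pair

variable {W W' : WeierstrassCurve ℚ} [W.IsElliptic] [W'.IsElliptic] {C C' : VariableChange ℚ}

/-- **`W ∼ W'` for a `ℤ/2`-linked pair**: `W ≅ C • W → (C • W).twoIsogenyCodomain = C' • W' ≅ W'`.
[cite: SilvermanAEC2009, III.4 Example 4.5 and III.4 (Def.)] -/
theorem isIsogenous_of_twoTorsionPair [(C • W).IsTwoTorsionNF]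
    (hlink : C' • W' = (C • W).twoIsogenyCodomain) : IsIsogenous W W' := by
  have h1 : IsIsogenous W (C • W) := isIsogenous_smul W C
  have h2 : IsIsogenous (C • W) (C • W).twoIsogenyCodomain := isIsogenous_twoIsogenyCodomain (C • W)
  have h3 : IsIsogenous W' (C' • W') := isIsogenous_smul W' C'
  rw [hlink] at h3
  exact (h1.trans' h2).trans' h3.symm_of_charZero

/-- **Good ordinary reduction at `2` passes along the pair** (good reduction: *AEC* VII.7.2; ordinarity:
`a₂(W) = a₂(W')`, Faltings). [cite: SilvermanAEC2009, Cor. VII.7.2] -/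
theorem goodOrd_two_iff_of_twoTorsionPair [W.IsGloballyMinimal] [W'.IsGloballyMinimal]
    [(C • W).IsTwoTorsionNF]
    (hlink : C' • W' = (C • W).twoIsogenyCodomain) : GoodOrd W 2 ↔ GoodOrd W' 2 := by
  haveI : Fact (Nat.Prime 2) := ⟨Nat.prime_two⟩
  have h := isIsogenous_of_twoTorsionPair hlink
  constructor
  · intro hgo
    exact ⟨(h.hasGoodReductionAtPrime_iff 2).mp hgo.1, (h.not_dvd_frobeniusTrace_iff 2 hgo.1).mp hgo.2⟩
  · intro hgo
    have h' := h.symm_of_charZero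
    exact ⟨(h'.hasGoodReductionAtPrime_iff 2).mp hgo.1, (h'.not_dvd_frobeniusTrace_iff 2 hgo.1).mp hgo.2⟩

/-- **Equal `corank_{ℤ₂} Sel_{2^∞}` along the pair** (an isogeny invariant; Greenberg LNM 1716 §1).
[cite: Greenberg1999LNM, §1 pp. 54–57] -/
theorem selmerCorank_two_eq_of_twoTorsionPair [(C • W).IsTwoTorsionNF]
    (hlink : C' • W' = (C • W).twoIsogenyCodomain) : W.selmerCorank 2 = W'.selmerCorank 2 := by
  have h := selmerCorankTwoInfty_eq_of_isIsogenous (isIsogenous_of_twoTorsionPair hlink)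
  rwa [selmerCorankTwoInfty_eq, selmerCorankTwoInfty_eq] at h

/-- **Equal analytic rank along the pair** (isogenous curves have the same `L`-function; Faltings /
Knapp Thm. 11.67). [cite: Knapp1993, Thm. 11.67] -/
theorem analyticRank_eq_of_twoTorsionPair [(C • W).IsTwoTorsionNF]
    (hlink : C' • W' = (C • W).twoIsogenyCodomain) : W.analyticRank = W'.analyticRank :=
  analyticRank_eq_of_isIsogenous' (isIsogenous_of_twoTorsionPair hlink)

/-- **CM passes along the pair** (CM is an isogeny invariant, *AEC* III.6/III.9).
[cite: SilvermanAEC2009, Thm. III.6.1(a), Cor. III.6.3 and Cor. III.9.4] -/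
theorem hasCM_iff_of_twoTorsionPair [(C • W).IsTwoTorsionNF]
    (hlink : C' • W' = (C • W).twoIsogenyCodomain) : W.HasCM ↔ W'.HasCM :=
  ⟨Summit.BirchSwinnertonDyer.Rank1Residual.X12.hasCM_of_isIsogenous (isIsogenous_of_twoTorsionPair hlink),
    Summit.BirchSwinnertonDyer.Rank1Residual.X12.hasCM_of_isIsogenous
      (isIsogenous_of_twoTorsionPair hlink).symm_of_charZero⟩

/-- **Item 19218's instance is a property of the pair**: the rank-`0` `2`-converse holds at `W` iff it
holds at `W'`. [cite: Greenberg1999LNM, §1 pp. 54–57] [cite: Knapp1993, Thm. 11.67] -/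
theorem rankZeroTwoConverseAt_iff_of_twoTorsionPair [(C • W).IsTwoTorsionNF]
    (hlink : C' • W' = (C • W).twoIsogenyCodomain) :
    (W.selmerCorank 2 = 0 → W.analyticRank = 0) ↔ (W'.selmerCorank 2 = 0 → W'.analyticRank = 0) := by
  rw [selmerCorank_two_eq_of_twoTorsionPair hlink, analyticRank_eq_of_twoTorsionPair hlink]

/-- The same for the `r ≤ 1` leaf shape `corank = r ⟹ r_an = r`. [cite: Greenberg1999LNM, §1 pp. 54–57] [cite: Knapp1993, Thm. 11.67] -/
theorem twoConverseAt_iff_of_twoTorsionPair [(C • W).IsTwoTorsionNF]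
    (hlink : C' • W' = (C • W).twoIsogenyCodomain) (r : ℕ) :
    (W.selmerCorank 2 = r → W.analyticRank = r) ↔ (W'.selmerCorank 2 = r → W'.analyticRank = r) := by
  rw [selmerCorank_two_eq_of_twoTorsionPair hlink, analyticRank_eq_of_twoTorsionPair hlink]

end Pair

/-! ## §2 Greenberg's Props. 5.13 / 5.14 read on the pair (PRINT binders by name) -/

section Greenberg

variable {W W' : WeierstrassCurve ℚ} [W.IsElliptic] [W.IsGloballyMinimal] [W'.IsElliptic]
  [W'.IsGloballyMinimal] {C C' : VariableChange ℚ}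

/-- **A Prop-5.14 point on `W` gives `Λ`-torsion and `μ = 0` for BOTH members of the pair** (Greenberg's
Prop. 5.14 BY NAME at `(W, P)` and — through the kernel duality `prop514Hypothesis_iff_of_twoIsogeny` —
at `(W', P')`). [cite: GreenbergLNM1716, Prop. 5.14 (chunk p0170)] -/
theorem isTorsion_mu_eq_zero_both_of_prop514 (h514 : prop514_isTorsion_mu_eq_zero_two)
    (hgo : GoodOrd W 2) [(C • W).IsTwoTorsionNF] (hlink : C' • W' = (C • W).twoIsogenyCodomain)
    (hΦ : (TwoTorsionRamifiedAtTwo C.r ∧ ¬ TwoTorsionOdd W C.r) ∨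
      (TwoTorsionOdd W C.r ∧ ¬ TwoTorsionRamifiedAtTwo C.r)) :
    (∀ (κ : ZpExtension ℚ 2) (γ : Field.absoluteGaloisGroup ℚ), κ.IsCyclotomic → κ.IsTopGenerator γ →
        ∀ D : W.SelmerDualData κ γ, D.IsTorsion ∧ D.mu = 0) ∧
      (∀ (κ : ZpExtension ℚ 2) (γ : Field.absoluteGaloisGroup ℚ), κ.IsCyclotomic → κ.IsTopGenerator γ →
        ∀ D : W'.SelmerDualData κ γ, D.IsTorsion ∧ D.mu = 0) := by
  haveI : (C' • W').IsTwoTorsionNF := by rw [hlink]; infer_instance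
  have hgo' : GoodOrd W' 2 := (goodOrd_two_iff_of_twoTorsionPair hlink).mp hgo
  have ha₁ := odd_a₁_integralModelInt_of_goodOrd_or_mult W (Or.inl hgo)
  have ha₁' := odd_a₁_integralModelInt_of_goodOrd_or_mult W' (Or.inl hgo')
  have hΦ' := (prop514Hypothesis_iff_of_twoIsogeny W W' C C' ha₁ ha₁' hlink).mp hΦ
  exact ⟨fun κ γ hκ hγ D ↦ h514 W (Or.inl ⟨hgo.1, hgo.2⟩) C.r C.t
      (equation_r_t_of_isTwoTorsionNF_smul W C) (two_mul_t_add_eq_zero_of_isTwoTorsionNF_smul W C)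
      hΦ κ γ hκ hγ D,
    fun κ γ hκ hγ D ↦ h514 W' (Or.inl ⟨hgo'.1, hgo'.2⟩) C'.r C'.t
      (equation_r_t_of_isTwoTorsionNF_smul W' C') (two_mul_t_add_eq_zero_of_isTwoTorsionNF_smul W' C')
      hΦ' κ γ hκ hγ D⟩

/-- **A Prop-5.13 point (ramified AND odd) on `W`: `μ(W) ≥ 1` (5.13 BY NAME), the partner point `P'` is
«NEITHER ramified nor odd» (kernel), and Prop. 5.14's hypothesis FAILS at `(W, P)` and at `(W', P')`** —
LNM 1716 §5 is silent on both members of such a pair. [cite: GreenbergLNM1716, Prop. 5.13 (chunk p0168) and Prop. 5.14 (chunk p0170)] -/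
theorem prop513_obstruction_of_twoTorsionPair (h513 : prop513_one_le_mu_two_of_ramified_odd)
    (hgo : GoodOrd W 2) [(C • W).IsTwoTorsionNF] (hlink : C' • W' = (C • W).twoIsogenyCodomain)
    (hram : TwoTorsionRamifiedAtTwo C.r) (hodd : TwoTorsionOdd W C.r) :
    (∀ (κ : ZpExtension ℚ 2) (γ : Field.absoluteGaloisGroup ℚ), κ.IsCyclotomic → κ.IsTopGenerator γ →
        ∀ D : W.SelmerDualData κ γ, D.IsTorsion → 1 ≤ D.mu) ∧
      (¬ TwoTorsionRamifiedAtTwo C'.r ∧ ¬ TwoTorsionOdd W' C'.r) ∧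
      ¬ ((TwoTorsionRamifiedAtTwo C.r ∧ ¬ TwoTorsionOdd W C.r) ∨
          (TwoTorsionOdd W C.r ∧ ¬ TwoTorsionRamifiedAtTwo C.r)) ∧
      ¬ ((TwoTorsionRamifiedAtTwo C'.r ∧ ¬ TwoTorsionOdd W' C'.r) ∨
          (TwoTorsionOdd W' C'.r ∧ ¬ TwoTorsionRamifiedAtTwo C'.r)) := by
  have hgo' : GoodOrd W' 2 := (goodOrd_two_iff_of_twoTorsionPair hlink).mp hgo
  have ha₁ := odd_a₁_integralModelInt_of_goodOrd_or_mult W (Or.inl hgo)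
  have ha₁' := odd_a₁_integralModelInt_of_goodOrd_or_mult W' (Or.inl hgo')
  have hN : ¬ TwoTorsionRamifiedAtTwo C'.r ∧ ¬ TwoTorsionOdd W' C'.r :=
    (ramified_and_odd_iff_neither_of_twoIsogeny W W' C C' ha₁ ha₁' hlink).mp ⟨hram, hodd⟩
  refine ⟨fun κ γ hκ hγ D hX ↦ h513 W (Or.inl ⟨hgo.1, hgo.2⟩) C.r C.t
      (equation_r_t_of_isTwoTorsionNF_smul W C) (two_mul_t_add_eq_zero_of_isTwoTorsionNF_smul W C)
      hram hodd κ γ hκ hγ D hX, hN, not_xor_of_ramified_and_odd hram hodd, ?_⟩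
  rintro (⟨h, -⟩ | ⟨h, -⟩)
  · exact hN.1 h
  · exact hN.2 h

end Greenberg

/-! ## §3 The (β) piece of 19218 shrinks: «neither» is eliminated along the pair -/

/-- **The rank-`0` `2`-converse on stratum (β) from TWO configurations.**  If the converse holds for
every non-CM good-ordinary-at-`2` minimal `W` carrying a rational point of order `2` that is (M) «ramified
at `2` XOR odd» (Greenberg's Prop-5.14 configuration, `μ = 0` in print) and for every such `W` carrying a
point that is (R) «ramified at `2` AND odd» (Prop-5.13 configuration, `μ ≥ 1`), then it holds for EVERY
non-CM good-ordinary-at-`2` minimal `W` with a rational point of order `2`: a point that is «neither» is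
traded for the generator `P'` of the dual kernel on the minimal model `W'` of `W/⟨P⟩`, which is ramified
AND odd (`neither_iff_ramified_and_odd_of_twoIsogeny`), and corank, analytic rank, reduction type and CM
are isogeny invariants (§1). [cite: GreenbergLNM1716, Props. 5.13–5.14 (chunks p0168–p0170)]
[cite: SilvermanAEC2009, III.4 Example 4.5, Cor. VII.7.2 and VIII.8.3] -/
theorem goodOrd_twoTorsion_rankZero_of_mixed_of_ramifiedOdd
    (hM : ∀ (W : WeierstrassCurve ℚ) [W.IsElliptic] [W.IsGloballyMinimal], ¬ W.HasCM → GoodOrd W 2 →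
      (∃ x : ℚ, HasRationalTwoTorsionX W x ∧
        ((TwoTorsionRamifiedAtTwo x ∧ ¬ TwoTorsionOdd W x) ∨ (TwoTorsionOdd W x ∧ ¬ TwoTorsionRamifiedAtTwo x))) →
      W.selmerCorank 2 = 0 → W.analyticRank = 0)
    (hR : ∀ (W : WeierstrassCurve ℚ) [W.IsElliptic] [W.IsGloballyMinimal], ¬ W.HasCM → GoodOrd W 2 →
      (∃ x : ℚ, HasRationalTwoTorsionX W x ∧ TwoTorsionRamifiedAtTwo x ∧ TwoTorsionOdd W x) →
      W.selmerCorank 2 = 0 → W.analyticRank = 0) :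
    ∀ (W : WeierstrassCurve ℚ) [W.IsElliptic] [W.IsGloballyMinimal], ¬ W.HasCM → GoodOrd W 2 →
      (∃ P : W.toAffine.Point, P ≠ 0 ∧ 2 • P = 0) → W.selmerCorank 2 = 0 → W.analyticRank = 0 := by
  intro W _ _ hCM hgo hP hc
  obtain ⟨x₀, y₀, hEq, h2⟩ := (exists_two_torsion_iff_exists_hasRationalTwoTorsionX W).mp hP
  by_cases hmix : (TwoTorsionRamifiedAtTwo x₀ ∧ ¬ TwoTorsionOdd W x₀) ∨
      (TwoTorsionOdd W x₀ ∧ ¬ TwoTorsionRamifiedAtTwo x₀)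
  · exact hM W hCM hgo ⟨x₀, ⟨y₀, hEq, h2⟩, hmix⟩ hc
  by_cases hRO : TwoTorsionRamifiedAtTwo x₀ ∧ TwoTorsionOdd W x₀
  · exact hR W hCM hgo ⟨x₀, ⟨y₀, hEq, h2⟩, hRO⟩ hc
  -- «neither»: pass to the partner
  have hN : ¬ TwoTorsionRamifiedAtTwo x₀ ∧ ¬ TwoTorsionOdd W x₀ := by tauto
  -- the normal form `C • W`, `P ↦ (0,0)`
  set C : VariableChange ℚ := ⟨1, x₀, -W.a₁ / 2, y₀⟩ with hC
  have hns : W.toAffine.Nonsingular x₀ y₀ := (WeierstrassCurve.Affine.equation_iff_nonsingular).mp hEq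
  have hy₀ : y₀ = W.toAffine.negY x₀ y₀ := by
    rw [WeierstrassCurve.Affine.negY]; linear_combination h2
  haveI hNF : (C • W).IsTwoTorsionNF := isTwoTorsionNF_smul_of_two_nsmul_eq_zero two_ne_zero hns hy₀
  -- a globally minimal model `W'` of the codomain, linked by `C' = C₀⁻¹`
  obtain ⟨C₀, hmin⟩ := hasGlobalMinimalModel_rat_holds (C • W).twoIsogenyCodomain
  set W' : WeierstrassCurve ℚ := C₀ • (C • W).twoIsogenyCodomain with hW'
  haveI : W'.IsGloballyMinimal := hmin
  have hlink : C₀⁻¹ • W' = (C • W).twoIsogenyCodomain := inv_smul_smul C₀ _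
  haveI : (C₀⁻¹ • W').IsTwoTorsionNF := by rw [hlink]; infer_instance
  have hCr : C.r = x₀ := rfl
  -- transport the data
  have hgo' : GoodOrd W' 2 := (goodOrd_two_iff_of_twoTorsionPair hlink).mp hgo
  have hCM' : ¬ W'.HasCM := fun h ↦ hCM ((hasCM_iff_of_twoTorsionPair hlink).mpr h)
  have ha₁ := odd_a₁_integralModelInt_of_goodOrd_or_mult W (Or.inl hgo)
  have ha₁' := odd_a₁_integralModelInt_of_goodOrd_or_mult W' (Or.inl hgo')
  have hRO' : TwoTorsionRamifiedAtTwo C₀⁻¹.r ∧ TwoTorsionOdd W' C₀⁻¹.r :=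
    (neither_iff_ramified_and_odd_of_twoIsogeny W W' C C₀⁻¹ ha₁ ha₁' hlink).mp (hCr ▸ hN)
  have hx' : HasRationalTwoTorsionX W' C₀⁻¹.r := hasRationalTwoTorsionX_of_isTwoTorsionNF_smul W' C₀⁻¹
  have h' := hR W' hCM' hgo' ⟨C₀⁻¹.r, hx', hRO'⟩
  exact (rankZeroTwoConverseAt_iff_of_twoTorsionPair hlink).mpr h' hc

/-! ## §4 Item 19218 BY NAME from the Kolyvagin cone on the habitat and FOUR off-habitat pieces -/

/-- **The off-big-image rank-`0` complement at a good ordinary `2` from FOUR pieces**: (M) mixed and (R)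
ramified-odd rational `2`-torsion, (γ₁) `C₃`-image, (γ₂) `ρ̄₂` onto with `-Δ ∈ ℚ^{×2}` (conv-1 GEN 18's
three strata with (β) split along `ℤ/2`-linked pairs). [cite: GreenbergLNM1716, Props. 5.13–5.14 (chunks p0168–p0170)]
[cite: DokchitserDokchitserMathZ2012, Theorem (1)–(3) and Lemma] -/
theorem goodOrd_offBigImage_rankZero_of_four_pieces
    (hM : ∀ (W : WeierstrassCurve ℚ) [W.IsElliptic] [W.IsGloballyMinimal], ¬ W.HasCM → GoodOrd W 2 →
      (∃ x : ℚ, HasRationalTwoTorsionX W x ∧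
        ((TwoTorsionRamifiedAtTwo x ∧ ¬ TwoTorsionOdd W x) ∨ (TwoTorsionOdd W x ∧ ¬ TwoTorsionRamifiedAtTwo x))) →
      W.selmerCorank 2 = 0 → W.analyticRank = 0)
    (hR : ∀ (W : WeierstrassCurve ℚ) [W.IsElliptic] [W.IsGloballyMinimal], ¬ W.HasCM → GoodOrd W 2 →
      (∃ x : ℚ, HasRationalTwoTorsionX W x ∧ TwoTorsionRamifiedAtTwo x ∧ TwoTorsionOdd W x) →
      W.selmerCorank 2 = 0 → W.analyticRank = 0)
    (hγ₁ : ∀ (W : WeierstrassCurve ℚ) [W.IsElliptic] [W.IsGloballyMinimal], ¬ W.HasCM → GoodOrd W 2 →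
      (∀ P : W.toAffine.Point, 2 • P = 0 → P = 0) → IsSquare W.Δ →
      W.selmerCorank 2 = 0 → W.analyticRank = 0)
    (hγ₂ : ∀ (W : WeierstrassCurve ℚ) [W.IsElliptic] [W.IsGloballyMinimal], ¬ W.HasCM → GoodOrd W 2 →
      W.HasSurjectiveModNGaloisRep 2 → IsSquare (-W.Δ) →
      W.selmerCorank 2 = 0 → W.analyticRank = 0) :
    ∀ (W : WeierstrassCurve ℚ) [W.IsElliptic] [W.IsGloballyMinimal], ¬ W.HasCM → GoodOrd W 2 →
      ¬ (∀ m : ℕ, W.HasSurjectiveModNGaloisRep (2 ^ m : ℕ)) →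
      W.selmerCorank 2 = 0 → W.analyticRank = 0 :=
  goodOrd_offBigImage_rankZero_of_three_strata (goodOrd_twoTorsion_rankZero_of_mixed_of_ramifiedOdd hM hR)
    hγ₁ hγ₂

/-- **Item 19218 `GoodOrdinaryRankZeroTwoConverse` BY NAME from Kolyvagin at `2` on the habitat (V1′ 24622 +
V2♭ 24623 + 24405 + PRINT, conv-1 GEN 17 p607060) and the FOUR off-habitat pieces (M), (R), (γ₁), (γ₂).**
The route decl, fully qualified.  Nothing here is unconditional: every binder is a research statement or a
printed fact displayed by name. [cite: WZhang2014, Thm. 1.1 (shape at p ≥ 5)]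
[cite: GreenbergLNM1716, Props. 5.13–5.14 (chunks p0168–p0170)] -/
theorem goodOrdinaryRankZeroTwoConverse_of_kolyvaginAtTwo_of_four_pieces
    (hV1 : KolyvaginNonvanishingAtTwoFrame) (hV2 : KolyvaginCorankLowerBoundAtTwo)
    (hT : NoTwoTorsionOverK)
    (hmod : exists_isNewformOf)
    (hBFH : bumpFriedbergHoffstein_exists_heegnerField_split_twist_simpleZero)
    (hpar : ∀ (V : WeierstrassCurve ℚ) [V.IsElliptic], p_parity V 2)
    (hGZK : rank_eq_analyticRank_of_analyticRank_le_one)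
    (hE : WeierstrassCurve.hasEntireLFunction_rat)
    (hGZ : ∀ (V : WeierstrassCurve ℚ) (N : ℕ) [NeZero N] (K : Type) [Field K] [NumberField K],
      analyticRankEK_eq_one_iff_heegner_nonTorsion V N K)
    (hrec : ∀ (N : ℕ) [NeZero N] (V : WeierstrassCurve ℚ) (K : Type) [Field K] [NumberField K],
      heegnerPointOfConductor_one_galoisConj N V K)
    (hM : ∀ (W : WeierstrassCurve ℚ) [W.IsElliptic] [W.IsGloballyMinimal], ¬ W.HasCM → GoodOrd W 2 →
      (∃ x : ℚ, HasRationalTwoTorsionX W x ∧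
        ((TwoTorsionRamifiedAtTwo x ∧ ¬ TwoTorsionOdd W x) ∨ (TwoTorsionOdd W x ∧ ¬ TwoTorsionRamifiedAtTwo x))) →
      W.selmerCorank 2 = 0 → W.analyticRank = 0)
    (hR : ∀ (W : WeierstrassCurve ℚ) [W.IsElliptic] [W.IsGloballyMinimal], ¬ W.HasCM → GoodOrd W 2 →
      (∃ x : ℚ, HasRationalTwoTorsionX W x ∧ TwoTorsionRamifiedAtTwo x ∧ TwoTorsionOdd W x) →
      W.selmerCorank 2 = 0 → W.analyticRank = 0)
    (hγ₁ : ∀ (W : WeierstrassCurve ℚ) [W.IsElliptic] [W.IsGloballyMinimal], ¬ W.HasCM → GoodOrd W 2 →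
      (∀ P : W.toAffine.Point, 2 • P = 0 → P = 0) → IsSquare W.Δ →
      W.selmerCorank 2 = 0 → W.analyticRank = 0)
    (hγ₂ : ∀ (W : WeierstrassCurve ℚ) [W.IsElliptic] [W.IsGloballyMinimal], ¬ W.HasCM → GoodOrd W 2 →
      W.HasSurjectiveModNGaloisRep 2 → IsSquare (-W.Δ) →
      W.selmerCorank 2 = 0 → W.analyticRank = 0) :
    Summit.BirchSwinnertonDyer.BirchSwinnertonDyer.Theses.TwoAdicConverse.GoodOrdinaryRankZeroTwoConverse :=
  goodOrdinaryRankZeroTwoConverse_of_kolyvaginAtTwo_of_three_strata hV1 hV2 hT hmod hBFH hpar hGZK hE hGZ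
    hrec (goodOrd_twoTorsion_rankZero_of_mixed_of_ramifiedOdd hM hR) hγ₁ hγ₂

end Summit.BirchSwinnertonDyer.BirchSwinnertonDyer.Theorems.TwoAdicOffHabitat

end
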